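import Summits.QuantumFields.QCD.Theses.DiagonalSpine
import HarnessLib

/-!
# Route `DiagonalSpine` (QCD): the support item `DiagonalLemma` (stmt-QuantumFields-8930)

ARZELÀ–ASCOLI IN THE PARAMETER WITH A COUNTABLE OBSERVABLE INDEX: a family `F k i : ℝ^N → ℂ` (`k ∈ ℕ` the cutoff
index, `i` in a countable index type) that is bounded on compacts uniformly in `k` and equicontinuous on compacts uniformly
in `k` admits ONE strictly increasing `φ` along which `F (φ k) i x` converges for every `i` and every `x`.

Proof (diagonal argument through Tychonoff): pick a countable dense `D ⊆ ℝ^N`; the sequence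
`k ↦ (F k i d)_{(i,d) ∈ ι × D}` lives in the compact product `∏ closedBall 0 B_{i,d}` (`isCompact_univ_pi`) of the
first-countable space `(ι × D) → ℂ` (countable index), so a subsequence `φ` converges coordinatewise
(`IsCompact.tendsto_subseq`); at any other `x`, equicontinuity on the compact `closedBall x 1` and a point of `D` within
`δ` make `k ↦ F (φ k) i x` Cauchy, hence convergent (`ℂ` complete).  Pure topology over Mathlib; nothing is asserted about
QCD; no summit, leg or crux statement is proved (width seat ym-t4-w17 g0, free hands; the item carried an unlanded candidate
proof of 2026-08-15 by grounder g21-0, unreadable from this seat — re-derived here).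
-/

set_option autoImplicit false

namespace Summit.QuantumFields.QCD.Theorems

open Filter Topology Metric Set

/-- **Diagonal subsequence lemma** (Arzelà–Ascoli in a parameter, countable observable index). [folklore] -/
theorem exists_strictMono_tendsto_of_equicontinuous (ι : Type) [Countable ι] (N : ℕ) (F : ℕ → ι → (Fin N → ℝ) → ℂ)
    (hb : ∀ i, ∀ K : Set (Fin N → ℝ), IsCompact K → ∃ B : ℝ, ∀ k, ∀ x ∈ K, ‖F k i x‖ ≤ B)
    (heq : ∀ i, ∀ K : Set (Fin N → ℝ), IsCompact K → ∀ ε > 0, ∃ δ > 0,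
      ∀ k, ∀ x ∈ K, ∀ y ∈ K, dist x y < δ → ‖F k i x - F k i y‖ < ε) :
    ∃ φ : ℕ → ℕ, StrictMono φ ∧ ∀ i x, ∃ c : ℂ, Tendsto (fun k => F (φ k) i x) atTop (𝓝 c) := by
  -- a countable dense set of evaluation points
  obtain ⟨D, hDc, hDd⟩ := TopologicalSpace.exists_countable_dense (Fin N → ℝ)
  haveI : Countable D := hDc.to_subtype
  -- coordinatewise bounds at the points of `D`
  have hB : ∀ j : ι × D, ∃ B : ℝ, ∀ k, ‖F k j.1 (j.2 : Fin N → ℝ)‖ ≤ B := fun j => by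
    obtain ⟨B, hB⟩ := hb j.1 {(j.2 : Fin N → ℝ)} isCompact_singleton
    exact ⟨B, fun k => hB k _ (mem_singleton _)⟩
  choose B hB using hB
  -- the sequence in the compact product of closed balls
  let X : ℕ → (ι × D → ℂ) := fun k j => F k j.1 (j.2 : Fin N → ℝ)
  have hS : IsCompact (Set.pi Set.univ fun j : ι × D => closedBall (0 : ℂ) (B j)) :=
    isCompact_univ_pi fun j => isCompact_closedBall _ _
  have hX : ∀ k, X k ∈ Set.pi Set.univ fun j : ι × D => closedBall (0 : ℂ) (B j) := fun k => by
    simp only [mem_univ_pi, mem_closedBall, dist_zero_right]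
    exact fun j => hB j k
  obtain ⟨a, -, φ, hφ, hlim⟩ := hS.tendsto_subseq hX
  refine ⟨φ, hφ, fun i x => ?_⟩
  -- convergence at the points of `D`
  have hD : ∀ d : D, Tendsto (fun k => F (φ k) i (d : Fin N → ℝ)) atTop (𝓝 (a (i, d))) := fun d => by
    have := (tendsto_pi_nhds.mp hlim) (i, d)
    exact this
  -- at a general point the subsequence is Cauchy
  have hC : CauchySeq fun k => F (φ k) i x := by
    refine Metric.cauchySeq_iff.mpr fun ε hε => ?_
    have hK : IsCompact (closedBall x 1) := isCompact_closedBall _ _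
    obtain ⟨δ, hδ, hδ'⟩ := heq i (closedBall x 1) hK (ε / 3) (by positivity)
    obtain ⟨d, hdD, hd⟩ := hDd.exists_dist_lt x (lt_min hδ one_pos)
    have hdx : d ∈ closedBall x 1 := by
      rw [mem_closedBall, dist_comm]; exact (hd.trans_le (min_le_right _ _)).le
    have hxx : x ∈ closedBall x 1 := mem_closedBall_self zero_le_one
    have hconv := (hD ⟨d, hdD⟩).cauchySeq
    obtain ⟨K₀, hK₀⟩ := Metric.cauchySeq_iff.mp hconv (ε / 3) (by positivity)
    refine ⟨K₀, fun m hm n hn => ?_⟩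
    have h1 : ‖F (φ m) i x - F (φ m) i d‖ < ε / 3 := hδ' (φ m) x hxx d hdx (hd.trans_le (min_le_left _ _))
    have h2 : dist (F (φ m) i d) (F (φ n) i d) < ε / 3 := hK₀ m hm n hn
    have h3 : ‖F (φ n) i x - F (φ n) i d‖ < ε / 3 := hδ' (φ n) x hxx d hdx (hd.trans_le (min_le_left _ _))
    have h3' : dist (F (φ n) i d) (F (φ n) i x) < ε / 3 := by rwa [dist_comm, dist_eq_norm]
    have h1' : dist (F (φ m) i x) (F (φ m) i d) < ε / 3 := by rwa [dist_eq_norm]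
    calc dist (F (φ m) i x) (F (φ n) i x)
        ≤ dist (F (φ m) i x) (F (φ m) i d) + dist (F (φ m) i d) (F (φ n) i d) + dist (F (φ n) i d) (F (φ n) i x) :=
          dist_triangle4 _ _ _ _
      _ < ε / 3 + ε / 3 + ε / 3 := by gcongr
      _ = ε := by ring
  exact cauchySeq_tendsto_of_complete hC

/-- **Item stmt-QuantumFields-8930 `DiagonalSpine.DiagonalLemma` holds.** [folklore] -/
theorem diagonalSpine_diagonalLemma_proof :
    Summit.QuantumFields.QCD.Theses.DiagonalSpine.DiagonalLemma := by
  unfold Summit.QuantumFields.QCD.Theses.DiagonalSpine.DiagonalLemma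
  intro ι _ N F hb heq
  exact exists_strictMono_tendsto_of_equicontinuous ι N F hb heq

end Summit.QuantumFields.QCD.Theorems
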